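import Summits.AnomalousDissipation.AnomalousDissipation.Theorems.QuarticGate.Negative.EnergyRow
import Summits.AnomalousDissipation.AnomalousDissipation.Theorems.QuarticGate.Negative.Laminar

/-!
# The cubic-certificate barrier for refuting `QuarticTightness`
(negative-side lemma; cdisprove seat of stmt-AnomalousDissipation-14331)

A refutation of `MomentParity.QuarticTightness` needs a force `f` and viscosities `ν_j → 0` such that
(i) the GATE HYPOTHESIS holds — `∀ j ∃ᶠ N ∃ μ, IsQuarticWitness f (ν j) N E ε μ` (loud 4-stationary
level-`N` laws, the body of `QuarticGate`) — while (ii) every bounded Galerkin ensemble of `f` is quiet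
uniformly in large `N` along a subsequence of `ν_j`. This file proves that (ii) can NOT be established by
the only kind of argument known to produce uniform quietness — a pointwise auxiliary-functional
(Lyapunov / Casimir / background / sum-of-squares) certificate of polynomial degree `≤ 3` — without
destroying (i) at the same time:

* `IsCubicCertificate f ν N E U g P λ`: band tests `g`, a polynomial `P` of total degree `≤ 3`, a
  multiplier `λ ≥ 0` and the pointwise inequality on level-`N` fields
  `ν‖∇u‖² + ⟨F(u), ∇p(u)⟩ + λ (E − ‖u‖²) ≤ U`, `p(u) = P((u,g₁),…,(u,g_m))`.
* `gateWitness_eps_le_of_cubicCertificate` (WEAK DUALITY): every level-`N` gate witness with energy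
  budget `E` and loudness `ε` has `ε ≤ U` — integrate the certificate: the generator row of the cubic
  observable `p` vanishes by 4-stationarity and the multiplier term is signed by the energy budget.
* `not_gateHyp_of_cubicCertificates`: if quietness of `f` along `ν` is certified at degree `3` (for every
  target `ε' > 0`, at some `j`, eventually in `N`, a certificate of value `< ε'`), the gate hypothesis fails
  for every `ε > 0`; so `(f, ν)` is never a counterexample. Every uniform-laminarisation proof in print
  (energy/enstrophy/helicity Lyapunov functions, Marchioro's `Z − λ₁E`, background flows = quadratic
  auxiliary functionals, cubic auxiliary functionals) is such a certificate (each in its own phase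
  space). A counterexample to the crux therefore needs a laminarisation mechanism invisible to cubic
  auxiliary functionals, `N`-uniformly in 3-D.
* `gateWitness_eps_le_of_injectionCertificate`, `backgroundCertificateBound_holds`: the same duality
  with the injection `(u,f)` as objective (`(u,f) − λ‖u‖² + ⟨F(u),∇p(u)⟩ ≤ c ⇒ ε ≤ c + λE`), i.e. the
  crux-ideate card `certificate-completeness`'s first lemma `BackgroundCertificateBound`, proved with
  its degree bound relaxed from `2` to `3`.
-/

namespace Summit.AnomalousDissipation.AnomalousDissipation.Theorems.QuarticTightness.Negative

set_option linter.dupNamespace false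

open MeasureTheory Filter Topology
open scoped ENNReal InnerProductSpace RealInnerProductSpace
open Literature.Analysis.FunctionSpaces Literature.Analysis.FluidPDE
open Summit.AnomalousDissipation.AnomalousDissipation.Theses.MomentParity
open Summit.AnomalousDissipation.AnomalousDissipation.Theorems
open Summit.AnomalousDissipation.AnomalousDissipation.Theorems.QuarticGate.Negative

noncomputable section

-- Type abbreviations `T3 = T³`, `R3 = ℝ³`, `H3 = H`, `L2T3 = L²(T³; ℝ³)` are the sibling crux's
-- (`Theorems/CubicParityLoud/Negative/Clauses.lean`).
open Summit.AnomalousDissipation.AnomalousDissipation.Theorems.CubicParityLoud.Negative (T3 R3 H3 L2T3)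


/-- The dissipation density `‖∇u‖²₂` of (the representative of) `u ∈ H`, as a real number. -/
def dissDensity (u : H3) : ℝ := (Torus.eGradNormSq ((u : L2T3) : T3 → R3)).toReal

/-- `dissDensity` is Borel measurable. [folklore] -/
theorem measurable_dissDensity : Measurable dissDensity :=
  Torus.measurable_eGradNormSq_coe.ennreal_toReal

/-- Bernstein, real form: `‖∇u‖² ≤ 4π²N²‖u‖²` on level-`N` fields. [folklore] -/
theorem dissDensity_le_of_isLevel {N : ℕ} {u : H3} (hu : IsLevel N u) :
    dissDensity u ≤ 4 * Real.pi ^ 2 * (N : ℝ) ^ 2 * ‖u‖ ^ 2 := by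
  have h := CubicParityLoud.Negative.eGradNormSq_le_of_isLevel (N := N) (u := u) hu
  have := ENNReal.toReal_mono ENNReal.ofReal_ne_top h
  rwa [ENNReal.toReal_ofReal (by positivity)] at this

/-- On a level-`N` law with finite mean energy the dissipation density is integrable. [folklore] -/
theorem integrable_dissDensity {N : ℕ} {μ : Measure H3} (hlev : ∀ᵐ u ∂μ, IsLevel N u)
    (h2 : Integrable (fun u : H3 => ‖u‖ ^ 2) μ) : Integrable dissDensity μ := by
  refine Integrable.mono' (h2.const_mul (4 * Real.pi ^ 2 * (N : ℝ) ^ 2))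
    measurable_dissDensity.aestronglyMeasurable ?_
  filter_upwards [hlev] with u hu
  rw [Real.norm_eq_abs, abs_of_nonneg (show 0 ≤ dissDensity u from ENNReal.toReal_nonneg)]
  exact dissDensity_le_of_isLevel hu

/-- **Dissipation as a Bochner integral** on level-`N` laws: `ensembleDissipation ν μ = ν ∫ ‖∇u‖² dμ`. [folklore] -/
theorem ensembleDissipation_eq_integral_dissDensity {ν : ℝ} {N : ℕ} {μ : Measure H3}
    (hlev : ∀ᵐ u ∂μ, IsLevel N u) :
    Torus.ensembleDissipation ν μ = ν * ∫ u, dissDensity u ∂μ := by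
  unfold Torus.ensembleDissipation Torus.ensembleEnstrophy dissDensity
  rw [integral_toReal Torus.measurable_eGradNormSq_coe.aemeasurable
    (hlev.mono fun u hu => CubicParityLoud.Negative.eGradNormSq_lt_top_of_isLevel hu)]

/-- A **CUBIC QUIETNESS CERTIFICATE** for the force `f` at viscosity `ν`, level `N`, energy budget
`E`, with value `U`: band tests `g`, a polynomial `P` of total degree `≤ 3` (so `p(u) = P((u,gᵢ))` is a
cubic auxiliary functional), a multiplier `λ ≥ 0` for the energy constraint, and the POINTWISE
inequality on level-`N` fields
`ν‖∇u‖² + ⟨F(u), ∇p(u)⟩ + λ (E − ‖u‖²) ≤ U`.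
This is the Lagrangian-dual / auxiliary-functional ("background", sum-of-squares) form of a dissipation
bound for Galerkin NS restricted to degree `≤ 3`; every quadratic Lyapunov/Casimir argument (energy,
enstrophy, helicity, Marchioro's `Z − λ₁E`, background flows) is the special case `deg P ≤ 2`. -/
def IsCubicCertificate (f : T3 → R3) (ν : ℝ) (N : ℕ) (E U : ℝ) {m : ℕ} (g : Fin m → T3 → R3)
    (P : MvPolynomial (Fin m) ℝ) (lam : ℝ) : Prop :=
  (∀ i, IsBandTest N (g i)) ∧ P.totalDegree + 1 ≤ 4 ∧ 0 ≤ lam ∧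
    ∀ u : H3, IsLevel N u →
      ν * dissDensity u + Torus.nsGeneratorPairing ν f u (polyGrad g P u) + lam * (E - ‖u‖ ^ 2) ≤ U

/-- **WEAK DUALITY: a cubic certificate bounds every gate witness** — if `(g, P, λ, U)` is a cubic
quietness certificate at `(f, ν, N, E)`, then every level-`N` 4-stationary law with `∫‖u‖⁴ < ∞`,
energy `≤ E` and dissipation `≥ ε` has `ε ≤ U`. (Integrate the pointwise inequality: the generator row of
the cubic observable `p` vanishes by 4-stationarity, the multiplier term is `≤ 0` by the energy budget.)
Hence any quietness theorem PROVED BY CUBIC CERTIFICATES kills the gate hypothesis together with the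
ladder conclusion, and cannot produce a counterexample to `QuarticTightness`. [folklore] -/
theorem gateWitness_eps_le_of_cubicCertificate {f : T3 → R3} {ν : ℝ} {N : ℕ} {E ε U : ℝ}
    {μ : Measure H3} (hw : IsQuarticWitness f ν N E ε μ) {m : ℕ} {g : Fin m → T3 → R3}
    {P : MvPolynomial (Fin m) ℝ} {lam : ℝ} (hc : IsCubicCertificate f ν N E U g P lam) : ε ≤ U := by
  obtain ⟨hprob, hlev, h4, hstat, hEn, hε⟩ := hw
  obtain ⟨hg, hP, hlam, hpt⟩ := hc
  have h2 : Integrable (fun u : H3 => ‖u‖ ^ 2) μ := integrable_norm_sq_of_norm_pow_four h4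
  obtain ⟨hGI, hG0⟩ := hstat m g P hg hP
  have hDI : Integrable dissDensity μ := integrable_dissDensity hlev h2
  have hM : Integrable (fun u : H3 => lam * (E - ‖u‖ ^ 2)) μ := ((integrable_const E).sub h2).const_mul lam
  have hνD : Integrable (fun u : H3 => ν * dissDensity u) μ := hDI.const_mul ν
  have hS1 : Integrable (fun u : H3 => ν * dissDensity u +
      Torus.nsGeneratorPairing ν f u (polyGrad g P u)) μ := hνD.add hGI
  have hS : Integrable (fun u : H3 => ν * dissDensity u +
      Torus.nsGeneratorPairing ν f u (polyGrad g P u) + lam * (E - ‖u‖ ^ 2)) μ := hS1.add hM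
  have hint_le : ∫ u, (ν * dissDensity u + Torus.nsGeneratorPairing ν f u (polyGrad g P u) +
      lam * (E - ‖u‖ ^ 2)) ∂μ ≤ ∫ _u, U ∂μ :=
    integral_mono_ae hS (integrable_const U) (hlev.mono fun u hu => hpt u hu)
  have hU : ∫ _u : H3, U ∂μ = U := by simp
  have hsplit : ∫ u, (ν * dissDensity u + Torus.nsGeneratorPairing ν f u (polyGrad g P u) +
      lam * (E - ‖u‖ ^ 2)) ∂μ = ν * ∫ u, dissDensity u ∂μ + 0 + lam * (E - ∫ u, ‖u‖ ^ 2 ∂μ) := by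
    rw [integral_add hS1 hM, integral_add hνD hGI, integral_const_mul, hG0, integral_const_mul,
      integral_sub (integrable_const E) h2]
    simp
  have hEn' : ∫ u, ‖u‖ ^ 2 ∂μ ≤ E := hEn
  have hdiss := ensembleDissipation_eq_integral_dissDensity (ν := ν) hlev
  have hmul : 0 ≤ lam * (E - ∫ u, ‖u‖ ^ 2 ∂μ) := mul_nonneg hlam (sub_nonneg.2 hEn')
  rw [hsplit, hU] at hint_le
  calc ε ≤ Torus.ensembleDissipation ν μ := hε
    _ = ν * ∫ u, dissDensity u ∂μ := hdiss
    _ ≤ U := by linarith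

/-- **THE BARRIER FOR DISPROOFS.** Suppose quietness of the force `f` along `ν` at energy budget `E` is
CERTIFIED AT DEGREE 3: for every target `ε' > 0` some viscosity index admits, at all but finitely many
levels, a cubic certificate of value `< ε'`. Then the gate hypothesis fails at `(f, ν, E, ε)` for every
`ε > 0` — so `(f, ν)` is not a counterexample to `QuarticTightness`, however quiet its invariant
ensembles are. A refutation needs a laminarisation mechanism invisible to cubic auxiliary functionals. [folklore] -/
theorem not_gateHyp_of_cubicCertificates {f : T3 → R3} {ν : ℕ → ℝ} {E ε : ℝ} (hε : 0 < ε)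
    (hcert : ∀ ε' : ℝ, 0 < ε' → ∃ j : ℕ, ∀ᶠ N in atTop,
      ∃ (U : ℝ) (m : ℕ) (g : Fin m → T3 → R3) (P : MvPolynomial (Fin m) ℝ) (lam : ℝ),
        U < ε' ∧ IsCubicCertificate f (ν j) N E U g P lam) :
    ¬ ∀ j : ℕ, ∃ᶠ N in atTop, ∃ μ, IsQuarticWitness f (ν j) N E ε μ := by
  intro hH
  obtain ⟨j, hj⟩ := hcert ε hε
  obtain ⟨N, ⟨μ, hμ⟩, U, m, g, P, lam, hU, hc⟩ := ((hH j).and_eventually hj).exists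
  exact absurd (gateWitness_eps_le_of_cubicCertificate hμ hc) (not_le.2 hU)

/-- **Injection form of weak duality (the `certificate-completeness` card's first lemma, proved, at
degree ≤ 3).** If on level-`N` fields `(u,f) − λ‖u‖² + ⟨F(u), ∇p(u)⟩ ≤ c` with `deg P ≤ 3`, `λ ≥ 0`, then
every gate witness has `ε ≤ c + λE`: integrate, kill the row by 4-stationarity, and use the energy row
`ensembleDissipation = ∫(u,f)dμ` (sibling `ensembleDissipation_eq_of_polyStationary`). This is
`Cruxes/QuarticTightness/Ideate3Sketch.lean :: BackgroundCertificateBound` with `P.totalDegree ≤ 2`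
relaxed to `≤ 3`. [folklore] -/
theorem gateWitness_eps_le_of_injectionCertificate {f : T3 → R3} (hf : MemLp f 2 volume) {ν : ℝ} {N : ℕ}
    {E ε c lam : ℝ} {μ : Measure H3} (hw : IsQuarticWitness f ν N E ε μ) {m : ℕ} {g : Fin m → T3 → R3}
    {P : MvPolynomial (Fin m) ℝ} (hg : ∀ i, IsBandTest N (g i)) (hP : P.totalDegree + 1 ≤ 4)
    (hlam : 0 ≤ lam)
    (hpt : ∀ u : H3, IsLevel N u →
      Torus.pairing u.1 f - lam * ‖u‖ ^ 2 + Torus.nsGeneratorPairing ν f u (polyGrad g P u) ≤ c) :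
    ε ≤ c + lam * E := by
  obtain ⟨hprob, hlev, h4, hstat, hEn, hε⟩ := hw
  have h2 : Integrable (fun u : H3 => ‖u‖ ^ 2) μ := integrable_norm_sq_of_norm_pow_four h4
  have h1 : Integrable (fun u : H3 => ‖u‖) μ := integrable_norm_of_norm_sq h2
  have hpI : Integrable (fun u : H3 => Torus.pairing u.1 f) μ :=
    CubicParityLoud.Negative.integrable_pairing hf h1
  obtain ⟨hGI, hG0⟩ := hstat m g P hg hP
  have hL : Integrable (fun u : H3 => lam * ‖u‖ ^ 2) μ := h2.const_mul lam
  have hS1 : Integrable (fun u : H3 => Torus.pairing u.1 f - lam * ‖u‖ ^ 2) μ := hpI.sub hL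
  have hS : Integrable (fun u : H3 => Torus.pairing u.1 f - lam * ‖u‖ ^ 2 +
      Torus.nsGeneratorPairing ν f u (polyGrad g P u)) μ := hS1.add hGI
  have hint_le : ∫ u, (Torus.pairing u.1 f - lam * ‖u‖ ^ 2 +
      Torus.nsGeneratorPairing ν f u (polyGrad g P u)) ∂μ ≤ ∫ _u, c ∂μ :=
    integral_mono_ae hS (integrable_const c) (hlev.mono fun u hu => hpt u hu)
  have hc : ∫ _u : H3, c ∂μ = c := by simp
  have hsplit : ∫ u, (Torus.pairing u.1 f - lam * ‖u‖ ^ 2 +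
      Torus.nsGeneratorPairing ν f u (polyGrad g P u)) ∂μ =
        ∫ u, Torus.pairing u.1 f ∂μ - lam * ∫ u, ‖u‖ ^ 2 ∂μ + 0 := by
    rw [integral_add hS1 hGI, integral_sub hpI hL, integral_const_mul, hG0]
  have hdiss : Torus.ensembleDissipation ν μ = ∫ u, Torus.pairing u.1 f ∂μ :=
    ensembleDissipation_eq_of_polyStationary f hf hlev h2 (by norm_num : (3 : ℕ) ≤ 4) hstat
  have hEn' : ∫ u, ‖u‖ ^ 2 ∂μ ≤ E := hEn
  rw [hsplit, hc] at hint_le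
  have hmul : lam * ∫ u, ‖u‖ ^ 2 ∂μ ≤ lam * E := mul_le_mul_of_nonneg_left hEn' hlam
  calc ε ≤ Torus.ensembleDissipation ν μ := hε
    _ = ∫ u, Torus.pairing u.1 f ∂μ := hdiss
    _ ≤ c + lam * E := by linarith

/-- The `certificate-completeness` card's `BackgroundCertificateBound` (verbatim shape, degree relaxed to
`≤ 3`), as a theorem. [folklore] -/
theorem backgroundCertificateBound_holds :
    ∀ (N m : ℕ) (g : Fin m → T3 → R3) (P : MvPolynomial (Fin m) ℝ) (ν : ℝ) (f : T3 → R3)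
      (lam c E ε : ℝ) (μ : Measure H3),
      0 < ν → 0 ≤ lam → Torus.IsSmooth f → (∀ i, IsBandTest N (g i)) → P.totalDegree ≤ 3 →
      (∀ u : H3, IsLevel N u →
        Torus.pairing u.1 f - lam * ‖u‖ ^ 2 + Torus.nsGeneratorPairing ν f u (polyGrad g P u) ≤ c) →
      IsQuarticWitness f ν N E ε μ → ε ≤ c + lam * E :=
  fun _ _ _ _ _ _ _ _ _ _ _ _ hlam hf hg hP hpt hw =>
    gateWitness_eps_le_of_injectionCertificate (hf.memLp 2) hw hg (by omega) hlam hpt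

end

end Summit.AnomalousDissipation.AnomalousDissipation.Theorems.QuarticTightness.Negative
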